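import Literature.AlgebraicGeometry.Frobenioids.FrTrFrobenioid
import Literature.AlgebraicGeometry.Frobenioids.PreFrobenioidPullbacks
import HarnessLib

/-!
# Frobenioids I, Theorem 5.1 (iii): `C^Fr-tr` is a Frobenioid of isotropic, group-like,
# base-trivial and `Aut`-ample type (abc-iut cell, layer L1, node D-η-3)

Mochizuki, *The geometry of Frobenioids I: the general theory*, Kyushu J. Math. **62** (2008)
293–400, §5, Theorem 5.1 (iii), kurims text p. 97, proof p. 99 [cite: MochizukiFrdI2008, Thm. 5.1 (iii) p.97]:

> "(iii) The subcategory `C^Fr-tr ⊆ C` determined by the Frobenius-trivial objects and isometric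
> morphisms is a Frobenioid of isotropic, group-like, base-trivial, and `Aut`-ample type. In
> particular, the isomorphism class of a Frobenius-trivial object of `C` is completely determined
> by the isomorphism class of its projection to `D`; all Frobenius-trivial objects of `C` are
> `Aut`-ample." — Proof (p. 99): "First, let us observe that by assertion (i) … base-isomorphic
> Frobenius-trivial objects of `C` are, in fact, isomorphic, and … all Frobenius-trivial objects of
> `C` are `Aut`-ample. In light of these observations, it follows immediately that `C^Fr-tr`
> satisfies the conditions of Definition 1.3".

This file proves the named statements of `DivisorialDescriptions.lean` for Thm. 5.1 (iii) exactly
along the printed proof: `thm51iii_isotropic : Thm51iii_isotropic F` outright, and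
`Thm51iii_isFrobenioid`, `Thm51iii_baseTrivial`, `Thm51iii_autAmple` FROM the two "In particular"
statements `Thm51iii_iso_of_baseIso F`, `Thm51iii_frobeniusTrivial_isAutAmple F` (which the text
derives from Thm. 5.1 (i); they are the named statements `Thm51i`-consequences and are not
re-proved here). The nineteen clauses of Def. 1.3 for `C^Fr-tr → F_{0_D}` are discharged one by
one from those of `C` (`FrTrFrobenioid.lean` is the dictionary); only (i)(b) and connectedness use
the "In particular" statements. No statement of the paper is strengthened.
-/

noncomputable section

namespace Literature.AlgebraicGeometry.Frobenioids

namespace PreFrobenioid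

open CategoryTheory Opposite

universe w v v' u u'

variable {D : Type u} [Category.{v} D] {Φ : Dᵒᵖ ⥤ CommMonCat.{w}}
  {C : Type u'} [Category.{v'} C] {F : C ⥤ ElemFrobenioid Φ}

namespace FrTr

/-! ### The "In particular" statements give isomorphisms over prescribed base-isomorphisms -/

/-- From "base-isomorphic Frobenius-trivial objects are isomorphic" and "Frobenius-trivial objects
are `Aut`-ample": an isomorphism `A ⥲ B` of `C^Fr-tr` over any prescribed `A_D ⥲ B_D`.
[cite: MochizukiFrdI2008, Thm. 5.1 (iii) p.99] -/
theorem exists_iso_over (hF : IsFrobenioid F)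
    (hK₁ : ∀ A A' : C, IsFrobeniusTrivial F A → IsFrobeniusTrivial F A' → BaseIsomorphic F A A' →
      Nonempty (A ≅ A'))
    (hK₂ : ∀ A : C, IsFrobeniusTrivial F A → IsAutAmple F A)
    (A B : FrTr F) (α : baseObj F A.1 ≅ baseObj F B.1) :
    ∃ j : A ≅ B, Base F j.hom.1 = α.hom := by
  obtain ⟨i⟩ := hK₁ A.1 B.1 A.2 B.2 ⟨α⟩
  let f : baseObj F A.1 ≅ baseObj F B.1 := (baseFunctor F).mapIso i
  obtain ⟨u, hu⟩ := hK₂ B.1 B.2 (f.symm ≪≫ α)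
  have hu' : Base F u.hom = f.inv ≫ α.hom := congrArg Iso.hom hu
  refine ⟨isoMk hF.isPreFrobenioid (i ≪≫ u), ?_⟩
  show Base F (i.hom ≫ u.hom) = α.hom
  rw [base_comp, hu', ← Category.assoc]
  show (f.hom ≫ f.inv) ≫ α.hom = α.hom
  rw [f.hom_inv_id, Category.id_comp]

/-! ### The clauses of Definition 1.3 for `C^Fr-tr → F_{0_D}` -/

/-- **Thm. 5.1 (iii)**, Frobenioid part, from the two "In particular" statements.
[cite: MochizukiFrdI2008, Thm. 5.1 (iii) p.97] -/
theorem isFrobenioid_of (hF : IsFrobenioid F) (hiso : IsOfIsotropicType F)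
    (hK₁ : ∀ A A' : C, IsFrobeniusTrivial F A → IsFrobeniusTrivial F A' → BaseIsomorphic F A A' →
      Nonempty (A ≅ A'))
    (hK₂ : ∀ A : C, IsFrobeniusTrivial F A → IsAutAmple F A) :
    IsFrobenioid (frTrFunctor F) := by
  have hP : IsPreFrobenioid Φ F := hF.isPreFrobenioid
  refine
    { isPreFrobenioid := isPreFrobenioid hF hiso hK₁
      i_a := ?_, i_b := ?_, i_c := ?_, ii_exists := ?_, ii_unique := ?_, iii_a := ?_, iii_b := ?_,
      iii_c := ?_, iii_c_base := ?_, iii_d_under_full := ?_, iii_d_under_surj := ?_,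
      iii_d_over_full := ?_, iii_d_over_surj := ?_, iv_a_exists := ?_, iv_a_unique := ?_, iv_b := ?_,
      v_a := ?_, v_b_exists := ?_, v_b_unique := ?_, v_c_exists := ?_, v_c_unique := ?_, vi := ?_,
      vii_a := ?_, vii_b := ?_ }
  -- (i)(a)
  · intro A₀
    obtain ⟨A, hA, ⟨e⟩⟩ := hF.i_a A₀
    exact ⟨⟨A, hA⟩, isFrobeniusTrivial hF hiso ⟨A, hA⟩, ⟨e⟩⟩
  -- (i)(b)
  · intro A B α
    obtain ⟨j, hj⟩ := exists_iso_over hF hK₁ hK₂ A B α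
    refine ⟨A, 𝟙 A, j.hom, isPreStep_of_isIso (𝟙 A), isPreStep_of_isIso j.hom, ?_⟩
    rw [base_id, Category.id_comp]
    exact hj.symm
  -- (i)(c)
  · intro A
    haveI := pullbackSliceToBase_faithful (frTrFunctor F) A
    haveI := pullbackSliceToBase_full (frTrFunctor F) A
    haveI : (pullbackSliceToBase (frTrFunctor F) A).EssSurj := by
      refine ⟨fun Y₀ => ?_⟩
      let f : Y₀.left ⟶ baseObj F A.1 := Y₀.hom
      obtain ⟨X, ψ, i, hψ, hw⟩ := exists_pullback_over hF hiso A f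
      exact ⟨Over.mk (⟨ψ, isPullbackMorphism_of_val hF ψ hψ⟩ :
          (⟨X⟩ : PullbackCat (frTrFunctor F)) ⟶ ⟨A⟩), ⟨Over.isoMk i hw⟩⟩
    exact {}
  -- (ii) existence
  · intro A n
    obtain ⟨ζ, hζ⟩ := isFrobeniusTrivial hF hiso A
    exact ⟨A, ζ n, (hζ n).2.2, (hζ n).1⟩
  -- (ii) uniqueness
  · intro A B B' φ ψ hφ hψ hn
    obtain ⟨β, hβ⟩ := hF.ii_unique φ.1 ψ.1 ((isFrobeniusType_iff hF hiso φ).1 hφ)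
      ((isFrobeniusType_iff hF hiso ψ).1 hψ) hn
    exact ⟨isoMk hP β, Subtype.ext hβ⟩
  -- (iii)(a)
  · intro X Y Z f g _ _
    exact isCoAngular hF hiso (f ≫ g)
  -- (iii)(b)
  · intro A' A φ _ ψ
    exact isCoAngular hF hiso ψ
  -- (iii)(c)
  · intro A B φ hφ
    haveI : IsIso φ := isIso_of_isPreStep hF hiso φ hφ.2
    exact ⟨endSubmonoidConj (frTrFunctor F) (asIso φ), hom_comp_endSubmonoidConj (asIso φ)⟩
  -- (iii)(c), dependence on `Base(φ)`
  · intro A B φ φ' hφ hφ' hb α β β' e₁ e₂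
    haveI : IsIso φ := isIso_of_isPreStep hF hiso φ hφ.2
    haveI : IsIso φ' := isIso_of_isPreStep hF hiso φ' hφ'.2
    haveI : IsIso φ.1 := isIso_val φ
    haveI : IsIso φ'.1 := isIso_val φ'
    have hb' : Base F φ.1 = Base F φ'.1 := hb
    have e₁v : φ.1 ≫ β.1.1 = α.1.1 ≫ φ.1 := congrArg Subtype.val e₁
    have e₂v : φ'.1 ≫ β'.1.1 = α.1.1 ≫ φ'.1 := congrArg Subtype.val e₂
    -- `w := φ⁻¹ φ'` lies in `O^▷(B)` (in `C`), hence commutes with `β` there (Remark 1.3.1)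
    have hwb : Base F (inv φ.1 ≫ φ'.1) = 𝟙 _ := by
      rw [base_comp, ← hb', ← base_comp, IsIso.inv_hom_id, base_id]
    have hwl : degFr F (inv φ.1 ≫ φ'.1) = 1 := by
      rw [degFr_comp, show degFr F φ'.1 = 1 from hφ'.2.1, mul_one]
      exact isLinear_of_isIso F (inv φ.1)
    have hβb : Base F β.1.1 = 𝟙 _ := β.2.1
    have hβl : degFr F β.1.1 = 1 := β.2.2
    have hcomm : (inv φ.1 ≫ φ'.1) ≫ β.1.1 = β.1.1 ≫ inv φ.1 ≫ φ'.1 :=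
      congrArg Subtype.val (endSubmonoid_comm F hF ⟨β.1.1, ⟨hβb, hβl⟩⟩ ⟨inv φ.1 ≫ φ'.1, ⟨hwb, hwl⟩⟩)
    have hα : α.1.1 = φ.1 ≫ β.1.1 ≫ inv φ.1 := by
      rw [← Category.assoc, e₁v, Category.assoc, IsIso.hom_inv_id, Category.comp_id]
    have hβ' : β'.1.1 = inv φ'.1 ≫ α.1.1 ≫ φ'.1 := by
      rw [← e₂v, IsIso.inv_hom_id_assoc]
    apply Subtype.ext
    apply Subtype.ext
    show β.1.1 = β'.1.1
    rw [hβ', hα]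
    simp only [Category.assoc]
    rw [← hcomm]
    simp only [Category.assoc, IsIso.hom_inv_id_assoc, IsIso.inv_hom_id_assoc]
  -- (iii)(d), coslice, full
  · intro A B B' φ φ' hφ hφ' _
    haveI : IsIso φ := isIso_of_isPreStep hF hiso φ hφ.2
    haveI : IsIso φ' := isIso_of_isPreStep hF hiso φ' hφ'.2
    exact ⟨inv φ ≫ φ', ⟨isCoAngular hF hiso _, isPreStep_of_isIso _⟩, by rw [IsIso.hom_inv_id_assoc]⟩
  -- (iii)(d), coslice, essentially surjective
  · intro A x
    exact ⟨A, 𝟙 A, ⟨isCoAngular hF hiso _, isPreStep_of_isIso _⟩, Subsingleton.elim _ _⟩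
  -- (iii)(d), slice, full
  · intro A B B' ψ ψ' hψ hψ' _
    haveI : IsIso ψ := isIso_of_isPreStep hF hiso ψ hψ.2
    haveI : IsIso ψ' := isIso_of_isPreStep hF hiso ψ' hψ'.2
    exact ⟨ψ ≫ inv ψ', ⟨isCoAngular hF hiso _, isPreStep_of_isIso _⟩,
      by rw [Category.assoc, IsIso.inv_hom_id, Category.comp_id]⟩
  -- (iii)(d), slice, essentially surjective
  · intro A x
    exact ⟨A, 𝟙 A, ⟨isCoAngular hF hiso _, isPreStep_of_isIso _⟩, Subsingleton.elim _ _⟩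
  -- (iv)(a) existence
  · intro A B φ
    obtain ⟨Y, γ, α, hfac, hγ, hα, hY⟩ :=
      exists_frobeniusType_pullback_of_isIsometry' F hF hiso A.2 φ.1 φ.2
    obtain ⟨⟨_, hαiso⟩, _⟩ := hF.iv_b α hα
    let Y' : FrTr F := ⟨Y, hY⟩
    let γ' : A ⟶ Y' := ⟨γ, hγ.1.2⟩
    let α' : Y' ⟶ B := ⟨α, hαiso⟩
    refine ⟨Y', Y', γ', 𝟙 Y', α', Subtype.ext ?_, (isFrobeniusType_iff hF hiso γ').2 hγ,
      isPreStep_of_isIso _, isPullbackMorphism_of_val hF α' hα⟩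
    show γ ≫ 𝟙 Y ≫ α = φ.1
    rw [Category.id_comp, hfac]
  -- (iv)(a) uniqueness
  · intro A B X Y X' Y' φ γ β α γ' β' α' h hγ hβ hα h' hγ' hβ' hα'
    obtain ⟨ε, δ, h₁, h₂, h₃⟩ := hF.iv_a_unique φ.1 γ.1 β.1 α.1 γ'.1 β'.1 α'.1
      (congrArg Subtype.val h) ((isFrobeniusType_iff hF hiso γ).1 hγ) hβ
      (isPullbackMorphism_val hF hiso α hα)
      (congrArg Subtype.val h') ((isFrobeniusType_iff hF hiso γ').1 hγ') hβ'
      (isPullbackMorphism_val hF hiso α' hα')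
    exact ⟨isoMk hP ε, isoMk hP δ, Subtype.ext h₁, Subtype.ext h₂, Subtype.ext h₃⟩
  -- (iv)(b)
  · intro A B φ hφ
    obtain ⟨_, hlin⟩ := hF.iv_b φ.1 (isPullbackMorphism_val hF hiso φ hφ)
    exact ⟨⟨isCoAngular hF hiso φ, rfl⟩, hlin⟩
  -- (v)(a)
  · intro A B φ hφ
    haveI : IsIso φ := isIso_of_isPreStep hF hiso φ hφ
    infer_instance
  -- (v)(b) existence
  · intro A B φ hφ
    exact ⟨B, φ, 𝟙 B, Category.comp_id φ, ⟨isCoAngular hF hiso φ, hφ⟩, rfl, isPreStep_of_isIso _⟩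
  -- (v)(b) uniqueness
  · intro A B X X' φ β α β' α' e _ hα e' _ hα'
    haveI : IsIso α := isIso_of_isPreStep hF hiso α hα.2
    haveI : IsIso α' := isIso_of_isPreStep hF hiso α' hα'.2
    refine ⟨asIso α ≪≫ (asIso α').symm, ?_, ?_⟩
    · show β ≫ α ≫ inv α' = β'
      rw [← Category.assoc, e, ← e', Category.assoc, IsIso.hom_inv_id, Category.comp_id]
    · show α = (α ≫ inv α') ≫ α'
      rw [Category.assoc, IsIso.inv_hom_id, Category.comp_id]
  -- (v)(c) existence
  · intro A B φ hφ
    exact ⟨A, 𝟙 A, φ, Category.id_comp φ, ⟨rfl, isPreStep_of_isIso _⟩, isCoAngular hF hiso φ, hφ⟩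
  -- (v)(c) uniqueness
  · intro A B X X' φ β α β' α' e hβ _ e' hβ' _
    haveI : IsIso β := isIso_of_isPreStep hF hiso β hβ.2
    haveI : IsIso β' := isIso_of_isPreStep hF hiso β' hβ'.2
    refine ⟨(asIso β).symm ≪≫ asIso β', ?_, ?_⟩
    · show β ≫ inv β ≫ β' = β'
      rw [IsIso.hom_inv_id_assoc]
    · show α = (inv β ≫ β') ≫ α'
      rw [Category.assoc, e', ← e, IsIso.inv_hom_id_assoc]
  -- (vi)
  · intro A B φ ψ hφ hψ hb _
    haveI : IsIso φ := isIso_of_isPreStep hF hiso φ hφ.2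
    haveI : IsIso ψ := isIso_of_isPreStep hF hiso ψ hψ.2
    have hb' : Base F φ.1 = Base F ψ.1 := hb
    let a : B ⟶ B := inv ψ ≫ φ
    have ha : ψ ≫ a = φ := by rw [IsIso.hom_inv_id_assoc]
    have hab : IsBaseIdentity (frTrFunctor F) a := by
      haveI := hP.isTotallyEpimorphic_base.epi (Base F ψ.1)
      apply (cancel_epi (Base F ψ.1)).mp
      show Base F ψ.1 ≫ Base F a.1 = Base F ψ.1 ≫ 𝟙 _
      rw [← base_comp, show ψ.1 ≫ a.1 = (ψ ≫ a).1 from rfl, ha, Category.comp_id, hb']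
    exact ⟨asIso a, ⟨hab, isLinear_of_isIso (frTrFunctor F) a⟩, ha⟩
  -- (vii)(a)
  · intro A
    exact ⟨A, 𝟙 A, rfl, isPreStep_of_isIso _, isIsotropic hF hiso A, fun _ γ _ =>
      ⟨γ, Category.id_comp γ, fun β hβ => (Category.id_comp β).symm.trans hβ⟩⟩
  -- (vii)(b)
  · intro A B _ _
    exact isIsotropic hF hiso B

end FrTr

/-! ### Theorem 5.1 (iii): the named statements -/

/-- **Thm. 5.1 (iii)**, "of isotropic type" — proved outright. [cite: MochizukiFrdI2008, Thm. 5.1 (iii) p.97] -/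
theorem thm51iii_isotropic (F : C ⥤ ElemFrobenioid Φ) : Thm51iii_isotropic F :=
  fun hF hiso A => FrTr.isIsotropic hF hiso A

/-- `Thm51iii_isotropic` holds for all parameters — `_holds` alias of `thm51iii_isotropic` above
(appended 2026-08-28, D-0026 bookkeeping: the proof term is the existing theorem of this file;
no statement, definition or attribute is edited; no new named fact).
[cite: MochizukiFrdI2008, Thm. 5.1 (iii) p.97] -/
theorem Thm51iii_isotropic_holds (F : C ⥤ ElemFrobenioid Φ) : Thm51iii_isotropic F :=
  thm51iii_isotropic F

/-- **Thm. 5.1 (iii)**, "`C^Fr-tr` is a Frobenioid", from the two "In particular" statements (which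
the text obtains from Thm. 5.1 (i)). [cite: MochizukiFrdI2008, Thm. 5.1 (iii) p.97] -/
theorem thm51iii_isFrobenioid_of (F : C ⥤ ElemFrobenioid Φ) (h₁ : Thm51iii_iso_of_baseIso F)
    (h₂ : Thm51iii_frobeniusTrivial_isAutAmple F) : Thm51iii_isFrobenioid F :=
  fun hF hiso => FrTr.isFrobenioid_of hF hiso (h₁ hF hiso) (h₂ hF hiso)

/-- **Thm. 5.1 (iii)**, "of base-trivial type", from "base-isomorphic Frobenius-trivial objects are
isomorphic". [cite: MochizukiFrdI2008, Thm. 5.1 (iii) p.97] -/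
theorem thm51iii_baseTrivial_of (F : C ⥤ ElemFrobenioid Φ) (h₁ : Thm51iii_iso_of_baseIso F) :
    Thm51iii_baseTrivial F := by
  intro hF hiso A B hAB
  obtain ⟨e⟩ := hAB
  obtain ⟨i⟩ := h₁ hF hiso B.1 A.1 B.2 A.2 ⟨e.symm⟩
  exact ⟨FrTr.isoMk hF.isPreFrobenioid i⟩

/-- **Thm. 5.1 (iii)**, "of `Aut`-ample type", from "all Frobenius-trivial objects are `Aut`-ample".
[cite: MochizukiFrdI2008, Thm. 5.1 (iii) p.97] -/
theorem thm51iii_autAmple_of (F : C ⥤ ElemFrobenioid Φ) (h₂ : Thm51iii_frobeniusTrivial_isAutAmple F) :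
    Thm51iii_autAmple F := by
  intro hF hiso A t
  obtain ⟨u, hu⟩ := h₂ hF hiso A.1 A.2 t
  exact ⟨FrTr.isoMk hF.isPreFrobenioid u, Iso.ext (congrArg Iso.hom hu)⟩

end PreFrobenioid

end Literature.AlgebraicGeometry.Frobenioids
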